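import Literature.MathematicalPhysics.KineticTheory.LangevinChainGeneratorStep
import Literature.MathematicalPhysics.KineticTheory.LangevinChainNoiseContinuity
import Literature.MathematicalPhysics.KineticTheory.LangevinChainLaSalle
import Literature.Probability.Process.BrownianSmallBall
import HarnessLib

/-!
# The pinned chain reaches every neighbourhood of its equilibrium with positive probability

Trunk T-KINETIC (Literature/MathematicalPhysics/KineticTheory). Provefact unit for the named fact
`CuneoEckmannHairerReyBellet2018_thm213` (`LangevinSemigroup.lean`). Cuneo–Eckmann–Hairer–
Rey-Bellet 2018, Prop. 3.3: "for every non-empty open set `U ⊂ Ω` and all `z ∈ Ω`, we have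
`sup_{t>0} P_t(z, U) > 0`" (via the Stroock–Varadhan support theorem and controllability). For the
transition kernels `OscillatorChain.transitionKernel` of the pinned anharmonic chain CONSTRUCTED
in `LangevinChainKernel.lean` (laws of the pathwise solution map driven by the pair of Wiener
measures) we PROVE the pointed form of this statement that the small-set argument actually uses
(`Literature/Probability/Process/SmallSets.lean` invokes irreducibility only towards the small
neighbourhood of the base point, which we may take to be the equilibrium `0`):

* `pinnedChain_transitionKernel_pos_of_mem_nhds_zero` — for every `z` and every neighbourhood
  `G` of `0` there is `s₀` with `P_t(z, G) > 0` for ALL `t ≥ s₀`;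
* `pinnedChain_exists_transitionKernel_pos_of_zero_mem` — the `∃ t` form.

Proof: the undriven trajectory `φ_t(z)` tends to `0` (LaSalle, `LangevinChainLaSalle.lean`), so
`‖φ_t(z)‖ < r/2` for `t ≥ s₀`; the flow is continuous in the noise path uniformly on `[0, t]`
(`LangevinChainNoiseContinuity.lean`), so `Φ_t(z, B) ∈ B(0, r) ⊆ G` as soon as
`sup_{s≤t} |B^{1,2}_s| ≤ ε'`; and this small ball of the Brownian pair has positive Wiener
measure (`BrownianSmallBall.lean`). This is the zero-control case of the support theorem; no
controllability of the chain is needed for the pointed statement.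

## References

* N. Cuneo, J.-P. Eckmann, M. Hairer, L. Rey-Bellet, *Non-equilibrium steady states for networks
  of oscillators*, Electron. J. Probab. 23 (2018) no. 55 (arXiv:1712.09413), Prop. 3.3.
* D. W. Stroock, S. R. S. Varadhan, *On the support of diffusion processes with applications to
  the strong maximum principle*, Proc. Sixth Berkeley Symp. III (1972) 333–359.
-/

noncomputable section

open MeasureTheory ProbabilityTheory Filter Topology Set Metric
open scoped NNReal ENNReal

namespace Literature.MathematicalPhysics.KineticTheory.HeatConduction

open Literature.Probability.Process OscillatorChain

variable {N : ℕ}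

/-! ### Pointed irreducibility of the pinned chain -/

section Pinned

variable {ω₂ lam β γ : ℝ} (hω : 0 < ω₂) (hl : 0 ≤ lam) (hβ : 0 ≤ β) (hγ : 0 < γ) (hN : 0 < N)
  (T_L T_R : ℝ)
include hω hl hβ hγ hN

/-- **The pinned chain reaches every neighbourhood of the origin with positive probability, at
all large times**: for `ω₂, γ > 0`, `lam, β ≥ 0`, `N ≥ 1`, any bath temperatures, every initial
condition `z` and every neighbourhood `G` of `0` there is `s₀` such that `P_t(z, G) > 0` for all
`t ≥ s₀`. The undriven trajectory enters `B(0, r/2) ⊆ G` for good (LaSalle); the flow is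
continuous in the noise on `[0, t]`; and the Brownian pair stays `ε'`-small on `[0, t]` with
positive probability. [cite: CuneoEckmannHairerReyBellet2018, Prop 3.3] -/
theorem pinnedChain_transitionKernel_pos_of_mem_nhds_zero (z : PhaseSpace N) {G : Set (PhaseSpace N)}
    (hG : G ∈ 𝓝 (0 : PhaseSpace N)) :
    ∃ s₀ : ℝ≥0, ∀ t : ℝ≥0, s₀ ≤ t → 0 < (pinnedChain ω₂ lam β γ).transitionKernel N T_L T_R t z G := by
  set P := pinnedChain ω₂ lam β γ with hP
  -- a ball inside `G`
  obtain ⟨r, hr, hrG⟩ := Metric.mem_nhds_iff.1 hG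
  -- LaSalle: the undriven trajectory is eventually in `B(0, r/2)`
  have hlim := pinnedChain_tendsto_freeFlow_zero hω hl hβ hγ hN z
  have hev : ∀ᶠ t : ℝ in atTop, ‖P.chainFlow N z 0 t‖ < r / 2 := by
    have := (Metric.tendsto_nhds.1 hlim) (r / 2) (half_pos hr)
    filter_upwards [this] with t ht
    rwa [dist_zero_right] at ht
  obtain ⟨s₁, hs₁⟩ := eventually_atTop.1 hev
  refine ⟨⟨max s₁ 0, le_max_right _ _⟩, fun t ht => ?_⟩
  have hts₁ : s₁ ≤ (t : ℝ) := (le_max_left s₁ 0).trans (by exact_mod_cast ht)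
  have hfree : ‖P.chainFlow N z 0 t‖ < r / 2 := hs₁ _ hts₁
  -- continuity in the noise on `[0, t]`, noise bounded by `1`
  obtain ⟨δ, hδ, hcont⟩ := pinnedChain_exists_norm_chainFlow_sub_lt hω hl hβ hγ.le N
    (P.hamiltonian N z) 1 (t : ℝ) (half_pos hr)
  -- the small ball of the Brownian pair
  set cL : ℝ := Real.sqrt (2 * γ * T_L) with hcL
  set cR : ℝ := Real.sqrt (2 * γ * T_R) with hcR
  set ε' : ℝ := min δ 1 / (|cL| + |cR| + 1) with hε'
  have hC : 0 < |cL| + |cR| + 1 := by positivity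
  have hε'0 : 0 < ε' := div_pos (lt_min hδ one_pos) hC
  have hε'b : (|cL| + |cR|) * ε' ≤ min δ 1 := by
    rw [hε', mul_div_assoc']
    rw [div_le_iff₀ hC]
    have : 0 ≤ min δ 1 := (lt_min hδ one_pos).le
    nlinarith
  set A : Set WienerPair := {ω | ∀ u : ℝ≥0, u ≤ t → |brownian u ω.1| ≤ ε' ∧ |brownian u ω.2| ≤ ε'}
    with hA
  have hApos : 0 < wienerPair A := wienerPair_forall_abs_brownian_le_pos t hε'0
  -- on `A`, the solution lands in `B(0, r)`
  have hsub : A ⊆ (fun ω => P.solMap N T_L T_R t z (pairPath ω)) ⁻¹' ball 0 r := by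
    intro ω hωA
    rw [mem_preimage, mem_ball, dist_zero_right]
    set η : ℝ → Fin N → ℝ := chainNoise N cL cR (pairPath ω) with hη
    have hηc : Continuous η := continuous_chainNoise cL cR (pairPath ω)
    have hηsmall : ∀ s ∈ Icc (0 : ℝ) t, ‖η s‖ ≤ min δ 1 := by
      intro s hs
      have hst : s.toNNReal ≤ t := Real.toNNReal_le_iff_le_coe.2 hs.2
      obtain ⟨h1, h2⟩ := hωA _ hst
      refine (norm_chainNoise_pairPath_le cL cR ω s).trans (le_trans ?_ hε'b)
      have hcL0 : 0 ≤ |cL| := abs_nonneg _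
      have hcR0 : 0 ≤ |cR| := abs_nonneg _
      nlinarith [mul_le_mul_of_nonneg_left h1 hcL0, mul_le_mul_of_nonneg_left h2 hcR0]
    have h1 : ‖P.chainFlow N z η t - P.chainFlow N z 0 t‖ < r / 2 :=
      hcont z le_rfl η 0 hηc continuous_zero
        (fun s hs => (hηsmall s hs).trans (min_le_right _ _))
        (fun s _ => by simp)
        (fun s hs => by simpa using (hηsmall s hs).trans (min_le_left _ _))
        t ⟨t.coe_nonneg, le_rfl⟩
    have hsol : P.solMap N T_L T_R t z (pairPath ω) = P.chainFlow N z η t := rfl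
    rw [hsol]
    calc ‖P.chainFlow N z η t‖ = ‖(P.chainFlow N z η t - P.chainFlow N z 0 t) + P.chainFlow N z 0 t‖ := by
          rw [sub_add_cancel]
      _ ≤ ‖P.chainFlow N z η t - P.chainFlow N z 0 t‖ + ‖P.chainFlow N z 0 t‖ := norm_add_le _ _
      _ < r / 2 + r / 2 := add_lt_add h1 hfree
      _ = r := by ring
  -- conclude
  calc (0 : ℝ≥0∞) < wienerPair A := hApos
    _ ≤ wienerPair ((fun ω => P.solMap N T_L T_R t z (pairPath ω)) ⁻¹' ball 0 r) := measure_mono hsub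
    _ = P.transitionKernel N T_L T_R t z (ball 0 r) :=
        (pinnedChain_transitionKernel_apply' hω hl hβ hγ.le N T_L T_R t z measurableSet_ball).symm
    _ ≤ P.transitionKernel N T_L T_R t z G := measure_mono hrG

/-- **Pointed irreducibility** (the `∃ t` form): every open set containing the origin is reached
from every point with positive probability. [cite: CuneoEckmannHairerReyBellet2018, Prop 3.3] -/
theorem pinnedChain_exists_transitionKernel_pos_of_zero_mem (z : PhaseSpace N) (U : Set (PhaseSpace N))
    (hU : IsOpen U) (h0 : (0 : PhaseSpace N) ∈ U) :
    ∃ t : ℝ≥0, 0 < (pinnedChain ω₂ lam β γ).transitionKernel N T_L T_R t z U := by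
  obtain ⟨s₀, hs₀⟩ := pinnedChain_transitionKernel_pos_of_mem_nhds_zero hω hl hβ hγ hN T_L T_R z
    (hU.mem_nhds h0)
  exact ⟨s₀, hs₀ s₀ le_rfl⟩

end Pinned

end Literature.MathematicalPhysics.KineticTheory.HeatConduction
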